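import Mathlib
import Summits.Ventures.PercRepro.TriangleCapBipartiteThree

/-!
# PercRepro — FOUR BELOW THE DIAGONAL ON THE TRIANGLE-FREE CLASS, PART A: EVERY EDGE OF A NON-BIPARTITE
TRIANGLE-FREE GRAPH HAS POSITIVE DEFICIT, AND THE STRUCTURE AT AN EDGE OF DEFICIT ONE (p3, gen 39; part 117)

In a triangle-free graph an edge `p q` with deficit `0` (`N(p) ∪ N(q) = V`) makes the graph bipartite with parts
`N(q)`, `N(p)` (both independent) — `deficit_pos_of_not_bipartite`.  An edge `p q` of deficit exactly `1`, with the
exceptional vertex `w`, gives `V = N(q) ⊔ N(p) ⊔ {w}`, and `w` has neighbours on both sides (`A_w ⊆ A = N(q)`,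
`B_w ⊆ B = N(p)`, else the graph is bipartite again), with no edge between `A_w` and `B_w`; with every degree
`≥ 2`, `A_w ≠ A` and `B_w ≠ B`.  The deficits: `(w, a) ≥ |A ∖ A_w|`, `(w, b) ≥ |B ∖ B_w|`, `(a, b) ≥ |B_w|` for
`a ∈ A_w`, `(a, b) ≥ |A_w|` for `b ∈ B_w`, and `≥ 1` (the vertex `w`) on the rest — the structural lemmas used by
part B.  Axioms: standard.
-/

namespace PercRepro

namespace TriangleCap

namespace C047

open Finset

variable {V : Type*} [Fintype V] [DecidableEq V]

omit [Fintype V] in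
/-- `CliqueFree 3` as the absence of triangles. -/
theorem no_triangle_of_cliqueFree (D : SimpleGraph V) (hfree : D.CliqueFree 3) :
    ∀ a b c, D.Adj a b → D.Adj a c → D.Adj b c → False := by
  intro a b c hab hac hbc
  exact hfree {a, b, c} (SimpleGraph.is3Clique_triple_iff.mpr ⟨hab, hac, hbc⟩)

/-- **Every edge of a non-bipartite triangle-free graph has deficit `≥ 1`:** a dominating pair `p q`
(`N(p) ∪ N(q) = V`) gives the bipartition `N(p)` / `N(q)`. -/
theorem deficit_pos_of_not_bipartite (D : SimpleGraph V) [DecidableRel D.Adj] (hfree : D.CliqueFree 3)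
    (hnb : ¬ ∃ A : Finset V, ∀ x y, D.Adj x y → (x ∈ A ↔ y ∉ A)) (p q : V) :
    1 ≤ deficit D (p, q) := by
  have htri := no_triangle_of_cliqueFree D hfree
  by_contra h
  push Not at h
  have h0 : deficit D (p, q) = 0 := by omega
  unfold deficit at h0
  rw [card_eq_zero, filter_eq_empty_iff] at h0
  have hcov : ∀ x, D.Adj p x ∨ D.Adj q x := by
    intro x
    by_contra hx
    push Not at hx
    exact h0 (mem_univ x) hx
  apply hnb
  refine ⟨univ.filter (fun x => D.Adj p x), ?_⟩
  intro x y hxy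
  simp only [mem_filter, mem_univ, true_and]
  constructor
  · intro hpx hpy
    exact htri p x y hpx hpy hxy
  · intro hpy
    by_contra hpx
    rcases hcov x with h | h
    · exact hpx h
    · rcases hcov y with h' | h'
      · exact hpy h'
      · exact htri q x y h h' hxy

omit [DecidableEq V] in
/-- The vertices adjacent to neither end of an edge of deficit one form a singleton. -/
theorem exists_unique_far_of_deficit_one (D : SimpleGraph V) [DecidableRel D.Adj] {p q : V}
    (h1 : deficit D (p, q) = 1) :
    ∃ w, ¬ D.Adj p w ∧ ¬ D.Adj q w ∧ ∀ x, ¬ D.Adj p x → ¬ D.Adj q x → x = w := by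
  unfold deficit at h1
  obtain ⟨w, hw⟩ := card_eq_one.mp h1
  have hwmem : w ∈ univ.filter (fun x => ¬ D.Adj p x ∧ ¬ D.Adj q x) := by rw [hw]; exact mem_singleton_self w
  rw [mem_filter] at hwmem
  refine ⟨w, hwmem.2.1, hwmem.2.2, ?_⟩
  intro x hpx hqx
  have : x ∈ univ.filter (fun x => ¬ D.Adj p x ∧ ¬ D.Adj q x) := mem_filter.mpr ⟨mem_univ x, hpx, hqx⟩
  rw [hw, mem_singleton] at this
  exact this

omit [DecidableEq V] in
/-- A deficit is at least the size of any set of vertices adjacent to neither end. -/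
theorem card_le_deficit (D : SimpleGraph V) [DecidableRel D.Adj] (S : Finset V) {x y : V}
    (hS : ∀ z ∈ S, ¬ D.Adj x z ∧ ¬ D.Adj y z) : S.card ≤ deficit D (x, y) := by
  unfold deficit
  apply card_le_card
  intro z hz
  exact mem_filter.mpr ⟨mem_univ z, hS z hz⟩

omit [Fintype V] [DecidableEq V] in
/-- Double counting the adjacent pairs of `X × Y`. -/
theorem sum_card_filter_adj_comm (D : SimpleGraph V) [DecidableRel D.Adj] (X Y : Finset V) :
    ∑ x ∈ X, (Y.filter (fun y => D.Adj x y)).card = ∑ y ∈ Y, (X.filter (fun x => D.Adj x y)).card := by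
  have h1 : ∑ x ∈ X, (Y.filter (fun y => D.Adj x y)).card =
      ((X ×ˢ Y).filter (fun p : V × V => D.Adj p.1 p.2)).card := by
    rw [card_filter, sum_product]
    apply sum_congr rfl
    intro x _
    rw [card_filter]
  have h2 : ∑ y ∈ Y, (X.filter (fun x => D.Adj x y)).card =
      ((X ×ˢ Y).filter (fun p : V × V => D.Adj p.1 p.2)).card := by
    rw [card_filter, sum_product_right]
    apply sum_congr rfl
    intro y _
    rw [card_filter]
  rw [h1, h2]

omit [DecidableEq V] in
/-- The deficit sum over the ordered adjacent pairs as a sum of row sums over the neighbourhoods. -/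
theorem sum_deficit_eq_sum_rows (D : SimpleGraph V) [DecidableRel D.Adj] :
    ∑ p ∈ adjPairsAll D, deficit D p = ∑ x, ∑ y ∈ univ.filter (fun y => D.Adj x y), deficit D (x, y) := by
  unfold adjPairsAll
  rw [sum_filter, sum_product]
  apply sum_congr rfl
  intro x _
  rw [sum_filter]

omit [DecidableEq V] in
/-- A row sum is at least the degree times a uniform lower bound. -/
theorem row_ge_of_pointwise (D : SimpleGraph V) [DecidableRel D.Adj] (x : V) (c : ℕ)
    (hc : ∀ y, D.Adj x y → c ≤ deficit D (x, y)) :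
    c * deg D x ≤ ∑ y ∈ univ.filter (fun y => D.Adj x y), deficit D (x, y) := by
  unfold deg
  rw [mul_comm, ← smul_eq_mul, ← sum_const]
  apply sum_le_sum
  intro y hy
  exact hc y (mem_filter.mp hy).2

end C047

end TriangleCap

end PercRepro
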